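import Summits.FinalStateConjecture.FinalStateConjecture.Theorems.ZeroEnergyKerrOrBombErgoregionBombModTCertificateCompactness

/-!
# `ErgoregionBombModT` — N1: the `Hess F`-sublevel zero-energy null vectors over a compact set are compact
# (crux stmt-FinalStateConjecture-17838, line `SketchIdeator4` / zero-energy escape, stub N1 `stub_hessianSublevelCompact`)

Route `ZeroEnergyKerrOrBomb` of the Final State Conjecture, crux `ErgoregionBombModT`, line
`SketchIdeator4` (zero-energy escape), v4 reshaping `ErgoregionBombModT ⇐ ZF₀` through the
`X`-free escape engine.  The engine transports the tangent lift of a confined zero-energy null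
geodesic by flow isometries to a zero-energy null vector over the compact set `S`, rescales it so
that `Hess F = 1`, and needs a *uniform* geodesic existence time on the set of such vectors; this
file supplies the compactness that makes the existence time uniform: for an escape function `F`,
`C²` on an open `W ⊇ S` with `Hess F_x(k, k) > 0` for every `x ∈ S` and every non-zero
zero-energy null `k` (`g(k, k) = 0`, `g(k, T) = 0`), the zero-energy null vectors `p` over `S`
with `Hess F(p, p) ≤ 1` lie in a compact subset of `TM`.

* `exists_isCompact_zeroEnergyNull_hessian_superset` — the general statement, for a `C^n` metric
  (`1 ≤ n`) with Levi-Civita connection on a locally compact Hausdorff manifold with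
  finite-dimensional complete model and a `C^n` vector field `T`.  Proof (the pattern of G5
  `exists_isCompact_null_frequency_superset`, p155062, and of the tree lemma
  `PseudoRiemannianMetric.exists_isCompact_tangent_superset`, Lee 2018, proof of Lemma 6.19, with
  the quadratic form `Hess F` in place of the linear form `dτ`): over a compact neighbourhood
  `N ⊆ W` of a point of `S` inside a trivialising chart `e` of `TM`, the three chart functions
  `(y, w) ↦ g_y(e⁻¹ w, e⁻¹ w)`, `(y, w) ↦ g_y(e⁻¹ w, T y)`, `(y, w) ↦ Hess F_y(e⁻¹ w, e⁻¹ w)` are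
  continuous, so the set `Z` of `(y, w) ∈ (N ∩ S) × {‖w‖ = 1}` with `e⁻¹ w` zero-energy null is
  compact and `Hess F ≥ m > 0` on `Z` (a unit chart vector is non-zero); by homogeneity (`g`,
  `Hess F` quadratic, `g(·, T)` linear in `w`) a zero-energy null `p` over `N ∩ S` with
  `Hess F(p, p) ≤ 1` has `m ‖e p‖² ≤ 1`, so `p` lies in the compact set
  `e⁻¹ (N × closedBall 0 √(1/m))`; finitely many such `N` cover `S`.
* `stub_hessianSublevelCompact` — the registered stub N1: the specialisation to the spacetime of a
  stationary asymptotically flat black hole `𝓑` (`T` the stationary Killing field, smooth; the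
  carrier, a `4`-manifold, is locally compact by `Manifold.locallyCompact_of_finiteDimensional`).

References: J. M. Lee, *Introduction to Riemannian Manifolds*, 2nd ed., GTM 176 (2018),
Lemma 6.19 (compactness over a compact set); B. O'Neill, *Semi-Riemannian geometry*, Academic
Press 1983, Ch. 3, Def. 3.48–Lemma 3.49 (the Hessian tensor); crux workfiles
`Cruxes/ErgoregionBombModT/Ideas/zero-energy-escape.md`, `Lines/SketchIdeator4.lean`.
-/

noncomputable section

open Bundle Set Filter Metric
open Literature.Geometry.Lorentzian
open scoped Manifold ContDiff Topology

-- summit = problem name (D-0017)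
set_option linter.dupNamespace false

namespace Summit.FinalStateConjecture.FinalStateConjecture.Theorems.ErgoregionBombModT

variable {E : Type*} [NormedAddCommGroup E] [NormedSpace ℝ E] {H : Type*} [TopologicalSpace H]
  {I : ModelWithCorners ℝ E H} {M : Type*} [TopologicalSpace M] [ChartedSpace H M]
  [IsManifold I ∞ M] {n : ℕ∞ω}

/-- **Compactness of the `Hess F`-sublevel zero-energy null vectors over a compact set.**  Let `g`
be a `C^n` metric (`1 ≤ n`) with Levi-Civita connection on a locally compact Hausdorff manifold
with finite-dimensional complete model, `T` a `C^n` vector field, `S` compact, `W ⊇ S` open, and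
`F` of class `C²` on `W` with `Hess F_x(k, k) > 0` for every `x ∈ S` and every non-zero
zero-energy null `k` (`g(k, k) = 0`, `g(k, T) = 0`).  Then there is a compact `𝒦 ⊆ TM` containing
every zero-energy null `p ∈ TM` over `S` with `Hess F(p, p) ≤ 1`.  Proof (pattern of
`exists_isCompact_null_frequency_superset` and of the tree lemma
`PseudoRiemannianMetric.exists_isCompact_tangent_superset`, Lee 2018, proof of Lemma 6.19): over a
compact neighbourhood `N ⊆ W` of a point of `S` inside a trivialising chart `e` of `TM`, the
continuous function `(y, w) ↦ Hess F_y(e⁻¹ w, e⁻¹ w)` has a positive minimum `m` on the compact set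
of `(y, w) ∈ (N ∩ S) × {‖w‖ = 1}` with `e⁻¹ w` zero-energy null (`e⁻¹ w ≠ 0`), so by homogeneity
a zero-energy null `p` over `N ∩ S` with `Hess F(p, p) ≤ 1` has `m ‖e p‖² ≤ 1` and lies in the
compact set `e⁻¹ (N × closedBall 0 √(1/m))`; finitely many such `N` cover `S`. [folklore] -/
theorem exists_isCompact_zeroEnergyNull_hessian_superset [LocallyCompactSpace M]
    [FiniteDimensional ℝ E] [CompleteSpace E] [T2Space M]
    (g : PseudoRiemannianMetric I n E (TangentSpace I : M → Type _)) [Fact (1 ≤ n)]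
    [g.HasLeviCivita] {T : Π x : M, TangentSpace I x}
    (hT : ContMDiff I (I.prod 𝓘(ℝ, E)) n
      (fun x ↦ (TotalSpace.mk' E x (T x) : TangentBundle I M)))
    {S W : Set M} {F : M → ℝ} (hS : IsCompact S) (hW : IsOpen W) (hSW : S ⊆ W)
    (hF : ContMDiffOn I 𝓘(ℝ, ℝ) 2 F W)
    (hpos : ∀ x ∈ S, ∀ k : TangentSpace I x, g.val x k k = 0 → g.val x k (T x) = 0 → k ≠ 0 →
      0 < g.hessian F x k k) :
    ∃ 𝒦 : Set (TangentBundle I M), IsCompact 𝒦 ∧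
      ∀ p : TangentBundle I M, p.proj ∈ S → g.val p.proj p.2 p.2 = 0 →
        g.val p.proj p.2 (T p.proj) = 0 → g.hessian F p.proj p.2 p.2 ≤ 1 → p ∈ 𝒦 := by
  -- the ingredients: continuity on `TM` / on `π ⁻¹' W`
  have hgc := g.continuous_val_tangentBundle
  have hTc := continuous_val_apply_section_tangentBundle g hT
  have hHF := continuousOn_hessian_tangentBundle g hW hF
  -- the local statement near each point of `S`
  have hloc : ∀ x ∈ S, ∃ N ∈ 𝓝 x, ∃ 𝒦 : Set (TangentBundle I M), IsCompact 𝒦 ∧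
      ∀ p : TangentBundle I M, p.proj ∈ N ∩ S → g.val p.proj p.2 p.2 = 0 →
        g.val p.proj p.2 (T p.proj) = 0 → g.hessian F p.proj p.2 p.2 ≤ 1 → p ∈ 𝒦 := by
    intro x hx
    set e := trivializationAt E (TangentSpace I : M → Type _) x with he_def
    have hxe : x ∈ e.baseSet := FiberBundle.mem_baseSet_trivializationAt' x
    obtain ⟨N, hN, hNe, hNc⟩ :=
      local_compact_nhds ((e.open_baseSet.inter hW).mem_nhds ⟨hxe, hSW hx⟩)
    have hNb : N ⊆ e.baseSet := hNe.trans inter_subset_left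
    have hNW : N ⊆ W := hNe.trans inter_subset_right
    -- the length function, the energy function and the Hessian in the chart `e`
    set Φ : M × E → ℝ := fun yw ↦ g.val yw.1 (e.symm yw.1 yw.2) (e.symm yw.1 yw.2) with hΦ_def
    set Ψ : M × E → ℝ := fun yw ↦ g.val yw.1 (e.symm yw.1 yw.2) (T yw.1) with hΨ_def
    set Θ : M × E → ℝ := fun yw ↦ g.hessian F yw.1 (e.symm yw.1 yw.2) (e.symm yw.1 yw.2)
      with hΘ_def
    have hΦc : ContinuousOn Φ (e.baseSet ×ˢ univ) := hgc.comp_continuousOn e.continuousOn_symm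
    have hΨc : ContinuousOn Ψ (e.baseSet ×ˢ univ) := hTc.comp_continuousOn e.continuousOn_symm
    have hΘc : ContinuousOn Θ ((e.baseSet ∩ W) ×ˢ univ) := by
      have h1 : ContinuousOn
          (fun z : M × E ↦ (TotalSpace.mk' E z.1 (e.symm z.1 z.2) : TangentBundle I M))
          ((e.baseSet ∩ W) ×ˢ univ) :=
        e.continuousOn_symm.mono (prod_mono inter_subset_left (subset_univ _))
      have h2 : MapsTo
          (fun z : M × E ↦ (TotalSpace.mk' E z.1 (e.symm z.1 z.2) : TangentBundle I M))
          ((e.baseSet ∩ W) ×ˢ univ) (TotalSpace.proj ⁻¹' W) := by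
        intro z hz
        exact hz.1.2
      -- elaborate the composition without expected type, then unify (cheap defeq)
      have h3 := hHF.comp h1 h2
      exact h3
    have hΦsmul : ∀ y ∈ e.baseSet, ∀ (c : ℝ) (w : E), Φ (y, c • w) = c ^ 2 * Φ (y, w) := by
      intro y hy c w
      simp only [hΦ_def]
      rw [← e.symmL_apply (R := ℝ) hy, ← e.symmL_apply (R := ℝ) hy, map_smul]
      simp only [map_smul, smul_apply, smul_eq_mul]
      ring
    have hΨsmul : ∀ y ∈ e.baseSet, ∀ (c : ℝ) (w : E), Ψ (y, c • w) = c * Ψ (y, w) := by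
      intro y hy c w
      simp only [hΨ_def]
      rw [← e.symmL_apply (R := ℝ) hy, ← e.symmL_apply (R := ℝ) hy, map_smul, map_smul,
        smul_apply, smul_eq_mul]
    have hΘsmul : ∀ y ∈ e.baseSet, ∀ (c : ℝ) (w : E), Θ (y, c • w) = c ^ 2 * Θ (y, w) := by
      intro y hy c w
      simp only [hΘ_def]
      rw [← e.symmL_apply (R := ℝ) hy, ← e.symmL_apply (R := ℝ) hy, map_smul]
      simp only [map_smul, LinearMap.smul_apply, smul_eq_mul]
      ring
    -- a positive lower bound for `Θ` on the zero-energy null unit chart vectors over `N ∩ S`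
    obtain ⟨m, hm, hmΘ⟩ : ∃ m : ℝ, 0 < m ∧ ∀ yw ∈ (N ∩ S) ×ˢ sphere (0 : E) 1,
        Φ yw = 0 → Ψ yw = 0 → m ≤ Θ yw := by
      set Z : Set (M × E) := (N ∩ S) ×ˢ sphere (0 : E) 1 ∩ Φ ⁻¹' {0} ∩ Ψ ⁻¹' {0} with hZ_def
      have hZsub : Z ⊆ (N ∩ S) ×ˢ sphere (0 : E) 1 := inter_subset_left.trans inter_subset_left
      have hc : IsCompact ((N ∩ S) ×ˢ sphere (0 : E) 1) :=
        (hNc.inter_right hS.isClosed).prod (isCompact_sphere 0 1)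
      have hsub : (N ∩ S) ×ˢ sphere (0 : E) 1 ⊆ e.baseSet ×ˢ univ :=
        prod_mono (inter_subset_left.trans hNb) (subset_univ _)
      have hZc : IsCompact Z := by
        refine hc.of_isClosed_subset ?_ hZsub
        have h1 : IsClosed ((N ∩ S) ×ˢ sphere (0 : E) 1 ∩ Φ ⁻¹' {0}) :=
          (hΦc.mono hsub).preimage_isClosed_of_isClosed hc.isClosed isClosed_singleton
        exact (hΨc.mono (inter_subset_left.trans hsub)).preimage_isClosed_of_isClosed h1
          isClosed_singleton
      by_cases hne : Z.Nonempty
      · have hcont : ContinuousOn Θ Z :=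
          hΘc.mono (hZsub.trans (prod_mono (subset_inter (inter_subset_left.trans hNb)
            (inter_subset_left.trans hNW)) (subset_univ _)))
        obtain ⟨yw₀, hyw₀, hmin⟩ := hZc.exists_isMinOn hne hcont
        refine ⟨Θ yw₀, ?_, fun yw hyw hΦ0 hΨ0 ↦ hmin ⟨⟨hyw, hΦ0⟩, hΨ0⟩⟩
        have hy₀ : yw₀.1 ∈ e.baseSet := hNb hyw₀.1.1.1.1
        have hw₀ : e.symm yw₀.1 yw₀.2 ≠ 0 := by
          intro h0
          have h2 : e.symmL ℝ yw₀.1 yw₀.2 = 0 := by rwa [e.symmL_apply (R := ℝ) hy₀]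
          have h3 := congrArg (e.continuousLinearMapAt ℝ yw₀.1) h2
          rw [e.continuousLinearMapAt_symmL hy₀, map_zero] at h3
          have h4 : ‖yw₀.2‖ = 1 := by simpa using hyw₀.1.1.2
          rw [h3, norm_zero] at h4
          exact zero_ne_one h4
        exact hpos _ hyw₀.1.1.1.2 _ hyw₀.1.2 hyw₀.2 hw₀
      · exact ⟨1, one_pos, fun yw hyw hΦ0 hΨ0 ↦ (hne ⟨yw, ⟨hyw, hΦ0⟩, hΨ0⟩).elim⟩
    -- the chart norm of a `Hess F`-sublevel zero-energy null vector over `N ∩ S` is bounded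
    have hbd : ∀ p : TangentBundle I M, p.proj ∈ N ∩ S → g.val p.proj p.2 p.2 = 0 →
        g.val p.proj p.2 (T p.proj) = 0 → g.hessian F p.proj p.2 p.2 ≤ 1 →
        ‖(e p).2‖ ^ 2 ≤ 1 / m := by
      intro p hp h0 hT0 hH
      have hpe : p.proj ∈ e.baseSet := hNb hp.1
      set w : E := (e p).2 with hw_def
      by_cases hw0 : w = 0
      · rw [hw0, norm_zero, zero_pow two_ne_zero]
        positivity
      · have hsym : e.symm p.proj w = p.2 := e.symm_proj_apply p hpe
        have hwpos : 0 < ‖w‖ := norm_pos_iff.2 hw0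
        set u : E := ‖w‖⁻¹ • w with hu_def
        have hu : u ∈ sphere (0 : E) 1 := by
          rw [mem_sphere_zero_iff_norm, hu_def, norm_smul, norm_inv, norm_norm,
            inv_mul_cancel₀ hwpos.ne']
        have hΦu : Φ (p.proj, u) = 0 := by
          have h3 : Φ (p.proj, w) = g.val p.proj p.2 p.2 := by simp only [hΦ_def, hsym]
          rw [hu_def, hΦsmul _ hpe, h3, h0, mul_zero]
        have hΨu : Ψ (p.proj, u) = 0 := by
          have h3 : Ψ (p.proj, w) = g.val p.proj p.2 (T p.proj) := by simp only [hΨ_def, hsym]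
          rw [hu_def, hΨsmul _ hpe, h3, hT0, mul_zero]
        have h1 : m ≤ Θ (p.proj, u) := hmΘ _ ⟨hp, hu⟩ hΦu hΨu
        have h2 : Θ (p.proj, u) = ‖w‖⁻¹ ^ 2 * Θ (p.proj, w) := hΘsmul _ hpe _ _
        have h3 : Θ (p.proj, w) = g.hessian F p.proj p.2 p.2 := by simp only [hΘ_def, hsym]
        rw [h2, h3] at h1
        have h4 : m * ‖w‖ ^ 2 ≤ 1 := by
          have h5 := mul_le_mul_of_nonneg_right h1 (sq_nonneg ‖w‖)
          calc m * ‖w‖ ^ 2 ≤ ‖w‖⁻¹ ^ 2 * g.hessian F p.proj p.2 p.2 * ‖w‖ ^ 2 := h5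
            _ = g.hessian F p.proj p.2 p.2 := by field_simp
            _ ≤ 1 := hH
        rw [le_div_iff₀ hm]
        linarith
    -- the compact set `e⁻¹ (N × closedBall)`
    refine ⟨N, hN, (fun yw : M × E ↦ (TotalSpace.mk' E yw.1 (e.symm yw.1 yw.2) :
      TangentBundle I M)) '' (N ×ˢ closedBall (0 : E) (Real.sqrt (1 / m))), ?_, ?_⟩
    · exact (hNc.prod (isCompact_closedBall 0 _)).image_of_continuousOn
        (e.continuousOn_symm.mono (prod_mono hNb (subset_univ _)))
    · intro p hp h0 hT0 hH
      have hpe : p.proj ∈ e.baseSet := hNb hp.1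
      have hps : p ∈ e.source := e.mem_source.2 hpe
      refine ⟨e p, ⟨?_, ?_⟩, ?_⟩
      · rw [e.coe_fst hps]
        exact hp.1
      · rw [mem_closedBall, dist_zero_right]
        calc ‖(e p).2‖ = Real.sqrt (‖(e p).2‖ ^ 2) := (Real.sqrt_sq (norm_nonneg _)).symm
          _ ≤ Real.sqrt (1 / m) := Real.sqrt_le_sqrt (hbd p hp h0 hT0 hH)
      · have hb : (e p).1 ∈ e.baseSet := by
          rw [e.coe_fst hps]
          exact hpe
        show TotalSpace.mk (e p).1 (e.symm (e p).1 (e p).2) = p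
        rw [e.mk_symm hb, Prod.mk.eta]
        exact e.toOpenPartialHomeomorph.left_inv hps
  -- cover `S` by finitely many such neighbourhoods
  choose N hN 𝒦 h𝒦 hmem using hloc
  obtain ⟨t, ht⟩ := hS.elim_nhds_subcover' N hN
  refine ⟨⋃ x ∈ t, 𝒦 x x.2, t.isCompact_biUnion fun x _ ↦ h𝒦 x x.2, fun p hp h0 hT0 hH ↦ ?_⟩
  obtain ⟨x, hx, hpx⟩ := mem_iUnion₂.1 (ht hp)
  exact mem_iUnion₂.2 ⟨x, hx, hmem x x.2 p ⟨hpx, hp⟩ h0 hT0 hH⟩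

/-- **N1 (compactness of the `Hess F`-sublevel zero-energy null vectors over a compact set).**  On
the spacetime of a stationary asymptotically flat black hole `𝓑` with stationary Killing field
`T = 𝓑.killing`: if `S` is compact, `W ⊇ S` open, `F` is `C²` on `W`, and `Hess F_x(k, k) > 0`
for every `x ∈ S` and every zero-energy null `k ≠ 0` (`g(k, k) = 0`, `g(k, T) = 0`), then the
zero-energy null vectors `p ∈ TM` over `S` with `Hess F(p, p) ≤ 1` lie in a compact subset of
`TM`.  This is `exists_isCompact_zeroEnergyNull_hessian_superset` for the metric of `𝓑` (the
Killing field is smooth; the carrier, a `4`-manifold, is locally compact,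
`Manifold.locallyCompact_of_finiteDimensional`). -/
theorem stub_hessianSublevelCompact : ∀ (𝓑 : Literature.Geometry.Lorentzian.StationaryAFBlackHole.{0}) [𝓑.metric.HasLeviCivita] (S W : Set 𝓑.carrier) (F : 𝓑.carrier → ℝ), IsCompact S → IsOpen W → S ⊆ W → ContMDiffOn (𝓡 4) 𝓘(ℝ, ℝ) 2 F W → (∀ x ∈ S, ∀ k : TangentSpace (𝓡 4) x, 𝓑.metric.val x k k = 0 → 𝓑.metric.val x k (𝓑.killing x) = 0 → k ≠ 0 → 0 < 𝓑.metric.toPseudoRiemannianMetric.hessian F x k k) → ∃ 𝒦 : Set (TangentBundle (𝓡 4) 𝓑.carrier), IsCompact 𝒦 ∧ ∀ p : TangentBundle (𝓡 4) 𝓑.carrier, p.proj ∈ S → 𝓑.metric.val p.proj p.2 p.2 = 0 → 𝓑.metric.val p.proj p.2 (𝓑.killing p.proj) = 0 → 𝓑.metric.toPseudoRiemannianMetric.hessian F p.proj p.2 p.2 ≤ 1 → p ∈ 𝒦 := by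
  intro 𝓑 _ S W F hS hW hSW hF hpos
  haveI : LocallyCompactSpace 𝓑.carrier :=
    Manifold.locallyCompact_of_finiteDimensional (M := 𝓑.carrier) (𝓡 4)
  exact exists_isCompact_zeroEnergyNull_hessian_superset 𝓑.metric.toPseudoRiemannianMetric
    𝓑.isStationaryKilling.isKillingField.contMDiff hS hW hSW hF hpos

end Summit.FinalStateConjecture.FinalStateConjecture.Theorems.ErgoregionBombModT

end
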